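import Summits.BirchSwinnertonDyer.BirchSwinnertonDyer.Theorems.GenusKolyvaginAtTwoPowDvdShaCardAtTwoRTRecordClauseOfDeepSwap
import Summits.BirchSwinnertonDyer.BirchSwinnertonDyer.Theorems.CMKolyvaginAtInertTwoLowerRungSupplyAtTwo
import HarnessLib

/-!
# Route `CMKolyvaginAtInertTwo`, crux `CMKolyvaginExactAtInertTwo` (stmt-BirchSwinnertonDyer-24277), `stub_lower` —
# PORT OF gk2's LINE 18, FILE B2: THE DROPS INTEGRATOR (record-depth clause of (P52rec[G])) WITHOUT THE IMAGE BINDERS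

Seat `bsd-line-cmk2-p1` g19 (cell `bsd-print-cf2`), `--supports stmt-BirchSwinnertonDyer-24277` (helper; closes nothing).
THEOREMS ONLY (no definition, no named fact, no `sorry`).  BSD is NOT proved by any of this; the crux is not closed here.

WHAT.  gk2-p2 g19's drops integrator `PlusDescent.exists_recordLevel_avoiding_of_deepSwap` (`…RTRecordClauseOfDeepSwap`): given the
minima at a record depth, the deep-swap socket `hswap` and the eigen index law `hK`, every `≤ r`-generated subgroup of `ε_r`-eigen Selmer
classes is avoided by `⟨2^{L−Mr'} c_L(d)⟩` for an admissible minimal depth-`r` level (gk2-p4's `exists_inv_avoiding_of_weakSwapOracle_pow`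
loop).  Its binders `¬ W.HasCM`, `ρ_{E,2^∞}` onto and the route decl Q2 are used ONLY through the rung supply
(`zsmul_kolyvaginClass_two_mem_selmerGroup_of_forall`, `…_mem_torsionLocalKer_of_forall`), which file A
(`CMKolyvaginAtInertTwoLowerRungSupplyAtTwo`) proves from `ρ̄_{E,2}` onto and Gross 1991 Prop. 3.7 (2) at `(W, K)` by name.  This file is
the integrator re-threaded over file A: statement = gk2-p2's with `(hQ2) (hcm) (hρ)` replaced by `(hρ2) (h37)`, proof VERBATIM (credit
gk2-p2 g19, gk2-p4).  Holds for every `W/ℚ` with `ρ̄_{E,2}` onto, in particular on H₂.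

References: [McCallumLMS1991] §5 Prop. 5.2 (proof pp. 308–310), §4 Prop. 4.4, Lemma 4.6; [Kolyvagin1991MathAnn] Thm. 2.1 (via [1, Prop. 8]);
[GrossLMS1991] §3 (3.1)–(3.3), Prop. 3.7 (2), §4.
-/

set_option autoImplicit false
-- the Theorems namespace of this sub repeats the summit name by design (D-0017 nested layout)
set_option linter.dupNamespace false

noncomputable section

open scoped Classical

namespace Summit.BirchSwinnertonDyer.BirchSwinnertonDyer.Theorems.KolyvaginLowerTwo

open WeierstrassCurve NumberField IsDedekindDomain Field Literature.NumberTheory.EllipticCurves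
  Literature.NumberTheory.GaloisRepresentations Literature.NumberTheory.EllipticCurves.ModularForms AddSubgroup
open Literature.NumberTheory.EllipticCurves.GrossLMS1991 (prop37_2_reductionCongruence_inert)
open Summit.BirchSwinnertonDyer.BirchSwinnertonDyer.Theorems.GenusExact
open Summit.BirchSwinnertonDyer.BirchSwinnertonDyer.Theorems.GenusExact.PlusDescent

variable {K : Type} [Field K] [NumberField K]

/-- **THE DROPS INTEGRATOR — the record-depth clause of (P52rec[G]) from the socket «[1, Prop. 8] at 2», WITHOUT the non-CM /
full-image binders** (gk2-p2 g19's `PlusDescent.exists_recordLevel_avoiding_of_deepSwap`, proof verbatim over file A's rung supply).  Frame: `E/ℚ`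
globally minimal with `ρ̄_{E,2}` onto and odd Tamagawa product (CM allowed); `K` imaginary quadratic, `d_K` odd, `≠ −3`, Heegner; Gross 3.7 (2)
at `(W, K)` granted; `τ ≠ 1`; a level
`L`, a record depth `r ≥ 1` with minima `Mr < Mr'` (`Mr' ≤ L`, the minimum at depth `r − 1`), over square-free levels whose primes are
Zhang–Kolyvagin of index `≥ L` and satisfy `G`; DISPLAYED: `hmin` / `hmin'` (the minima kill every datum class at depths `r` / `r−1`), `hatt`
(attainment at depth `r`), `hswap` (the deep swap: a new admissible prime detecting `2^{L−Mr−1} c_L(d)` and a datum at the swapped level with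
`2^{L−Mr−1} c_L(d′) ≠ 0`), `hK` (eigen index law at admissible primes).  THEN every `≤ r`-generated subgroup of `ε_r`-eigen Selmer classes
(`ε_r = −w(E)(−1)^r`) is avoided by `⟨2^{L−Mr'} c_L(d)⟩` for an admissible minimal depth-`r` `(n, d)`.  Proof: gk2-p4's
`exists_inv_avoiding_of_weakSwapOracle_pow` with `R = Sel ∩ eigen`, `A ℓ = ⨅_{v∋ℓ} torsionLocalKer_v`, `Inv`/`cls` as in the module docstring.
[cite: McCallumLMS1991, §5 Prop. 5.2 (proof pp. 308–310), §4 Prop. 4.4, Lemma 4.6] [cite: Kolyvagin1991MathAnn, Thm. 2.1] -/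
theorem exists_recordLevel_avoiding_of_deepSwap (W : WeierstrassCurve ℚ) [W.IsElliptic] [W.IsGloballyMinimal] [NeZero (W.conductorNorm ℤ)]
    (hρ2 : W.HasSurjectiveModNGaloisRep 2) (hT : Odd W.tamagawaProduct)
    (hIQ : IsImaginaryQuadratic K) (hodd : Odd (NumberField.discr K)) (h3 : NumberField.discr K ≠ -3)
    (hHe : SatisfiesHeegnerHypothesis (W.conductorNorm ℤ) K)
    (h37 : prop37_2_reductionCongruence_inert (W.conductorNorm ℤ) W K)
    (τ : K ≃ₐ[ℚ] K) (hτ : τ ≠ 1)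
    (Dt : ModularParametrizationData W (W.conductorNorm ℤ)) (β : ℤ) (ι : K →+* ℂ)
    (G : ℕ → Prop) {L r Mr Mr' : ℕ} (hL : 1 ≤ L) (hr : 1 ≤ r) (hdrop : Mr < Mr') (hMr'L : Mr' ≤ L)
    (hmin : ∀ (n : ℕ) (e : KolyvaginHeegnerData Dt β ι n), Squarefree n → n.primeFactors.card = r →
      (∀ q ∈ n.primeFactors, (Zhang2014.IsKolyvaginPrime (W.conductorNorm ℤ) W K 2 q ∧ L ≤ Zhang2014.kolyvaginIndex W 2 q) ∧ G q) →
      ((2 ^ (L - Mr) : ℕ) : ℤ) • e.kolyvaginClass Nat.prime_two L = 0)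
    (hmin' : ∀ (n : ℕ) (e : KolyvaginHeegnerData Dt β ι n), Squarefree n → n.primeFactors.card = r - 1 →
      (∀ q ∈ n.primeFactors, (Zhang2014.IsKolyvaginPrime (W.conductorNorm ℤ) W K 2 q ∧ L ≤ Zhang2014.kolyvaginIndex W 2 q) ∧ G q) →
      ((2 ^ (L - Mr') : ℕ) : ℤ) • e.kolyvaginClass Nat.prime_two L = 0)
    (hatt : ∃ (n : ℕ) (d : KolyvaginHeegnerData Dt β ι n), Squarefree n ∧ n.primeFactors.card = r ∧
      (∀ q ∈ n.primeFactors, (Zhang2014.IsKolyvaginPrime (W.conductorNorm ℤ) W K 2 q ∧ L ≤ Zhang2014.kolyvaginIndex W 2 q) ∧ G q) ∧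
      addOrderOf (d.kolyvaginClass Nat.prime_two L) = 2 ^ (L - Mr))
    (hswap : ∀ (n : ℕ) (d : KolyvaginHeegnerData Dt β ι n), Squarefree n → n.primeFactors.card = r →
      (∀ q ∈ n.primeFactors, (Zhang2014.IsKolyvaginPrime (W.conductorNorm ℤ) W K 2 q ∧ L ≤ Zhang2014.kolyvaginIndex W 2 q) ∧ G q) →
      addOrderOf (d.kolyvaginClass Nat.prime_two L) = 2 ^ (L - Mr) →
      ∀ ℓ₀ ∈ n.primeFactors, ∀ X : Finset ℕ, ∃ ℓ' : ℕ, ℓ' ∉ X ∧ ℓ' ∉ n.primeFactors ∧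
        ((Zhang2014.IsKolyvaginPrime (W.conductorNorm ℤ) W K 2 ℓ' ∧ L ≤ Zhang2014.kolyvaginIndex W 2 ℓ') ∧ G ℓ') ∧
        (∃ v : HeightOneSpectrum (𝓞 K), ((ℓ' : ℕ) : 𝓞 K) ∈ v.asIdeal ∧
          ((2 ^ (L - Mr - 1) : ℕ) : ℤ) • d.kolyvaginClass Nat.prime_two L ∉
            (W.baseChange K).torsionLocalKer (v.adicCompletion K) ((2 ^ L : ℕ) : ℤ)) ∧
        ∃ d' : KolyvaginHeegnerData Dt β ι (ℓ' * (n / ℓ₀)),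
          ((2 ^ (L - Mr - 1) : ℕ) : ℤ) • d'.kolyvaginClass Nat.prime_two L ≠ 0)
    (hK : ∀ ℓ : ℕ, (Zhang2014.IsKolyvaginPrime (W.conductorNorm ℤ) W K 2 ℓ ∧ L ≤ Zhang2014.kolyvaginIndex W 2 ℓ) ∧ G ℓ →
      ∀ C : AddSubgroup (galH1Torsion (W.baseChange K) ((2 ^ L : ℕ) : ℤ)),
      (∀ c ∈ C, c ∈ selmerGroup (W.baseChange K) ((2 ^ L : ℕ) : ℤ) ∧
        conjAct W τ ((2 ^ L : ℕ) : ℤ) c = (-W.rootNumber * (-1) ^ r) • c) →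
      (⨅ (v : HeightOneSpectrum (𝓞 K)) (_ : ((ℓ : ℕ) : 𝓞 K) ∈ v.asIdeal),
          (W.baseChange K).torsionLocalKer (v.adicCompletion K) ((2 ^ L : ℕ) : ℤ)).relIndex
        (C ⊓ AddSubgroup.torsionBy (galH1Torsion (W.baseChange K) ((2 ^ L : ℕ) : ℤ)) (2 : ℤ)) ∣ 2) :
    ∀ (i : ℕ) (u : Fin i → galH1Torsion (W.baseChange K) ((2 ^ L : ℕ) : ℤ)), i ≤ r →
      (∀ j, u j ∈ selmerGroup (W.baseChange K) ((2 ^ L : ℕ) : ℤ) ∧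
        conjAct W τ ((2 ^ L : ℕ) : ℤ) (u j) = (-W.rootNumber * (-1) ^ r) • u j) →
      ∃ (n : ℕ) (_ : Squarefree n)
        (_ : ∀ q ∈ n.primeFactors, (Zhang2014.IsKolyvaginPrime (W.conductorNorm ℤ) W K 2 q ∧
          L ≤ Zhang2014.kolyvaginIndex W 2 q) ∧ G q)
        (_ : n.primeFactors.card = r) (d : KolyvaginHeegnerData Dt β ι n),
        addOrderOf (d.kolyvaginClass Nat.prime_two L) = 2 ^ (L - Mr) ∧
        Disjoint (zmultiples (((2 ^ (L - Mr') : ℕ) : ℤ) • d.kolyvaginClass Nat.prime_two L))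
          (AddSubgroup.closure (Set.range u)) := by
  -- preliminaries
  have hne4 : NumberField.discr K ≠ -4 := fun h ↦ by
    rw [h] at hodd
    exact (Int.not_even_iff_odd.mpr hodd) ⟨-2, by norm_num⟩
  have hsurj1 : W.HasSurjectiveModNGaloisRep ((2 : ℤ) ^ 1) := by simpa using hρ2
  have hn0 : ((2 ^ L : ℕ) : ℤ) ≠ 0 := by positivity
  have h22 : ((2 : ℕ) : ℤ) = (2 : ℤ) := by norm_num
  -- freeze the sign (no unfolding of `rootNumber` during unification)
  generalize hε : (-W.rootNumber * (-1) ^ r : ℤ) = ε at hK ⊢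
  -- admissibility of a prime (opaque name + defining equivalence, to keep unification cheap)
  obtain ⟨Adm, hAdm⟩ : ∃ Adm : ℕ → Prop, ∀ q, Adm q ↔
      (Zhang2014.IsKolyvaginPrime (W.conductorNorm ℤ) W K 2 q ∧ L ≤ Zhang2014.kolyvaginIndex W 2 q) ∧ G q :=
    ⟨_, fun _ ↦ Iff.rfl⟩
  -- the ambient `R = Sel ∩ eigen(ε_r)` and the strict conditions `A ℓ`
  obtain ⟨Eig, hEig⟩ : ∃ Eig : AddSubgroup (galH1Torsion (W.baseChange K) ((2 ^ L : ℕ) : ℤ)),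
      ∀ c, c ∈ Eig ↔ conjAct W τ ((2 ^ L : ℕ) : ℤ) c = ε • c :=
    ⟨{ carrier := {c | conjAct W τ ((2 ^ L : ℕ) : ℤ) c = ε • c}
       add_mem' := fun {a b} ha hb ↦ by
         simp only [Set.mem_setOf_eq] at ha hb ⊢
         rw [map_add, ha, hb, zsmul_add]
       zero_mem' := by
         simp only [Set.mem_setOf_eq]
         rw [map_zero, zsmul_zero]
       neg_mem' := fun {a} ha ↦ by
         simp only [Set.mem_setOf_eq] at ha ⊢
         rw [map_neg, ha, zsmul_neg] }, fun _ ↦ Iff.rfl⟩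
  obtain ⟨R, hR⟩ : ∃ R : AddSubgroup (galH1Torsion (W.baseChange K) ((2 ^ L : ℕ) : ℤ)),
      R = selmerGroup (W.baseChange K) ((2 ^ L : ℕ) : ℤ) ⊓ Eig := ⟨_, rfl⟩
  have hRmem : ∀ c, c ∈ R ↔ c ∈ selmerGroup (W.baseChange K) ((2 ^ L : ℕ) : ℤ) ∧
      conjAct W τ ((2 ^ L : ℕ) : ℤ) c = ε • c := fun c ↦ by
    rw [hR, AddSubgroup.mem_inf, hEig]
  haveI : Finite (selmerGroup (W.baseChange K) ((2 ^ L : ℕ) : ℤ)) := (W.baseChange K).finite_selmerGroup_holds hn0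
  haveI hRfin : Finite R := Finite.of_injective _ (AddSubgroup.inclusion_injective (hR ▸ inf_le_left : R ≤ _))
  obtain ⟨A, hA⟩ : ∃ A : ℕ → AddSubgroup (galH1Torsion (W.baseChange K) ((2 ^ L : ℕ) : ℤ)), ∀ ℓ, A ℓ =
      ⨅ (v : HeightOneSpectrum (𝓞 K)) (_ : ((ℓ : ℕ) : 𝓞 K) ∈ v.asIdeal),
        (W.baseChange K).torsionLocalKer (v.adicCompletion K) ((2 ^ L : ℕ) : ℤ) := ⟨_, fun _ ↦ rfl⟩
  have hAmem : ∀ ℓ c, c ∈ A ℓ ↔ ∀ v : HeightOneSpectrum (𝓞 K), ((ℓ : ℕ) : 𝓞 K) ∈ v.asIdeal →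
      c ∈ (W.baseChange K).torsionLocalKer (v.adicCompletion K) ((2 ^ L : ℕ) : ℤ) := fun ℓ c ↦ by
    rw [hA, AddSubgroup.mem_iInf]
    exact forall_congr' fun v ↦ AddSubgroup.mem_iInf
  -- the invariant: `S` is the prime support of an admissible square-free level carrying a datum of order `2^(L − Mr)`
  obtain ⟨Inv, hInv⟩ : ∃ Inv : Finset ℕ → Prop, ∀ S, Inv S ↔ S.card = r ∧ ∃ (n : ℕ) (d : KolyvaginHeegnerData Dt β ι n),
      Squarefree n ∧ n.primeFactors = S ∧ (∀ q ∈ n.primeFactors, Adm q) ∧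
      addOrderOf (d.kolyvaginClass Nat.prime_two L) = 2 ^ (L - Mr) := ⟨_, fun _ ↦ Iff.rfl⟩
  -- the chosen datum of an invariant set and the ladder class `cls S = 2^(L − Mr') • c_L(d_S)`
  let lvl : ∀ S, Inv S → ℕ := fun S h ↦ ((hInv S).mp h).2.choose
  let dat : ∀ S (h : Inv S), KolyvaginHeegnerData Dt β ι (lvl S h) := fun S h ↦ ((hInv S).mp h).2.choose_spec.choose
  have hdat : ∀ S (h : Inv S), Squarefree (lvl S h) ∧ (lvl S h).primeFactors = S ∧ (∀ q ∈ (lvl S h).primeFactors, Adm q) ∧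
      addOrderOf ((dat S h).kolyvaginClass Nat.prime_two L) = 2 ^ (L - Mr) := fun S h ↦
    ((hInv S).mp h).2.choose_spec.choose_spec
  obtain ⟨cls, hcls_eq⟩ : ∃ cls : Finset ℕ → galH1Torsion (W.baseChange K) ((2 ^ L : ℕ) : ℤ), ∀ S (h : Inv S),
      cls S = ((2 ^ (L - Mr') : ℕ) : ℤ) • (dat S h).kolyvaginClass Nat.prime_two L :=
    ⟨fun S ↦ if h : Inv S then ((2 ^ (L - Mr') : ℕ) : ℤ) • (dat S h).kolyvaginClass Nat.prime_two L else 0,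
      fun S h ↦ dif_pos h⟩
  -- the exponent bookkeeping
  have ha1 : 1 ≤ Mr' - Mr := by omega
  have hexp : Mr' - Mr - 1 + (L - Mr') = L - Mr - 1 := by omega
  -- properties of a multiple `2^(L − Mr') • c_L(d)` at an admissible minimal depth-`r` level
  have hsub : ∀ (n : ℕ), Squarefree n → n.primeFactors.card = r → (∀ q ∈ n.primeFactors, Adm q) →
      ∀ ℓ ∈ n.primeFactors, ∀ e : KolyvaginHeegnerData Dt β ι (n / ℓ),
        ((2 ^ (L - Mr') : ℕ) : ℤ) • e.kolyvaginClass Nat.prime_two L = 0 := by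
    intro n hn hcard hadm ℓ hℓ e
    obtain ⟨hsq', hsubset, hcard'⟩ := squarefree_div_primeFactors' hn hℓ
    exact hmin' (n / ℓ) e hsq' (by omega) (fun q hq ↦ (hAdm q).mp (hadm q (hsubset hq)))
  have hgood_cls : ∀ (n : ℕ) (d : KolyvaginHeegnerData Dt β ι n), Squarefree n → n.primeFactors.card = r →
      (∀ q ∈ n.primeFactors, Adm q) → addOrderOf (d.kolyvaginClass Nat.prime_two L) = 2 ^ (L - Mr) →
      ((2 ^ (L - Mr') : ℕ) : ℤ) • d.kolyvaginClass Nat.prime_two L ∈ R ∧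
      addOrderOf (((2 ^ (L - Mr') : ℕ) : ℤ) • d.kolyvaginClass Nat.prime_two L) = 2 ^ (Mr' - Mr) ∧
      ∀ ℓ ∈ n.primeFactors, ((2 ^ (L - Mr') : ℕ) : ℤ) • d.kolyvaginClass Nat.prime_two L ∈ A ℓ := by
    intro n d hn hcard hadm hord
    have hKol : ∀ q ∈ n.primeFactors, Zhang2014.IsKolyvaginPrime (W.conductorNorm ℤ) W K 2 q ∧ L ≤ Zhang2014.kolyvaginIndex W 2 q :=
      fun q hq ↦ ((hAdm q).mp (hadm q hq)).1
    refine ⟨(hRmem _).mpr ⟨?_, ?_⟩, ?_, fun ℓ hℓ ↦ (hAmem ℓ _).mpr fun v hv ↦ ?_⟩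
    · exact KolyvaginLowerTwo.zsmul_kolyvaginClass_two_mem_selmerGroup_of_forall W Dt β ι hρ2 hIQ h3 hne4 hHe hT h37 L (L - Mr') hn hKol d
        (hsub n hn hcard hadm)
    · rw [conjAct_zsmul_kolyvaginClass_two W Dt β ι hIQ h3 hne4 hodd hHe hsurj1 τ hτ hn hL hKol d (L - Mr'), hcard, hε]
    · exact addOrderOf_zsmul_kolyvaginClass_two W Dt β ι d (le_of_lt hdrop) hMr'L hord
    · exact KolyvaginLowerTwo.zsmul_kolyvaginClass_two_mem_torsionLocalKer_of_forall W Dt β ι hρ2 hIQ h3 hne4 hHe h37 L (L - Mr') hn hKol d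
        (hsub n hn hcard hadm) hℓ v hv
  -- the loop's three inputs
  have hKloop : ∀ ℓ, Adm ℓ → ∀ t : Finset (galH1Torsion (W.baseChange K) ((2 ^ L : ℕ) : ℤ)),
      (↑t : Set (galH1Torsion (W.baseChange K) ((2 ^ L : ℕ) : ℤ))) ⊆ R →
      (A ℓ).relIndex (AddSubgroup.closure (↑t : Set (galH1Torsion (W.baseChange K) ((2 ^ L : ℕ) : ℤ))) ⊓
        AddSubgroup.torsionBy (galH1Torsion (W.baseChange K) ((2 ^ L : ℕ) : ℤ)) ((2 : ℕ) : ℤ)) ∣ 2 := by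
    intro ℓ hℓ t ht
    have hle : AddSubgroup.closure (↑t : Set (galH1Torsion (W.baseChange K) ((2 ^ L : ℕ) : ℤ))) ≤ R :=
      (AddSubgroup.closure_le R).mpr ht
    have hCsub : ∀ c ∈ AddSubgroup.closure (↑t : Set (galH1Torsion (W.baseChange K) ((2 ^ L : ℕ) : ℤ))),
        c ∈ selmerGroup (W.baseChange K) ((2 ^ L : ℕ) : ℤ) ∧ conjAct W τ ((2 ^ L : ℕ) : ℤ) c = ε • c :=
      fun c hc ↦ (hRmem c).mp (hle hc)
    have key := hK ℓ ((hAdm ℓ).mp hℓ) _ hCsub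
    rw [hA, h22]
    exact key
  have hclsloop : ∀ S, Inv S → (∀ l ∈ S, Adm l) →
      cls S ∈ R ∧ addOrderOf (cls S) = 2 ^ (Mr' - Mr) ∧ Mr' - Mr ≤ Mr' - Mr ∧ ∀ l ∈ S, cls S ∈ A l := by
    intro S hS' _
    obtain ⟨hsqS, hpfS, hadmS, hordS⟩ := hdat S hS'
    obtain ⟨hRc, hordcls, hAc⟩ := hgood_cls (lvl S hS') (dat S hS') hsqS (by rw [hpfS, ((hInv S).mp hS').1]) hadmS hordS
    rw [hcls_eq S hS']
    exact ⟨hRc, hordcls, le_rfl, fun ℓ hℓ ↦ hAc ℓ (by rw [hpfS]; exact hℓ)⟩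
  have horacle : ∀ S, Inv S → ∀ ℓ₀ ∈ S, ∃ ℓ', ℓ' ∉ S ∧ Adm ℓ' ∧ Inv (insert ℓ' (S.erase ℓ₀)) ∧
      2 ^ (Mr' - Mr - 1) • cls S ∉ A ℓ' := by
    intro S hS' ℓ₀ hℓ₀
    obtain ⟨hsqS, hpfS, hadmS, hordS⟩ := hdat S hS'
    have hcardS : S.card = r := ((hInv S).mp hS').1
    have hℓ₀' : ℓ₀ ∈ (lvl S hS').primeFactors := by rw [hpfS]; exact hℓ₀
    obtain ⟨ℓ', hℓ'S, hℓ'n, hadm', ⟨v, hv, hdet⟩, d', hd'⟩ :=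
      hswap (lvl S hS') (dat S hS') hsqS (by rw [hpfS, hcardS]) (fun q hq ↦ (hAdm q).mp (hadmS q hq)) hordS ℓ₀ hℓ₀' S
    have hℓ'p : ℓ'.Prime := hadm'.1.1.1
    obtain ⟨hsq', -, -, -, hpf'⟩ := RelaxedCount.squarefree_div_mul hsqS hℓ₀' hℓ'p hℓ'n
    have hadm'' : ∀ q ∈ (ℓ' * (lvl S hS' / ℓ₀)).primeFactors, Adm q := fun q hq ↦ by
      rw [hpf', Finset.mem_insert] at hq
      rcases hq with rfl | hq
      · exact (hAdm _).mpr hadm'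
      · exact hadmS q (Finset.mem_of_mem_erase hq)
    have hcard'' : (ℓ' * (lvl S hS' / ℓ₀)).primeFactors.card = r := by
      rw [hpf', Finset.card_insert_of_notMem (fun h ↦ hℓ'n (Finset.mem_of_mem_erase h)), Finset.card_erase_of_mem hℓ₀', hpfS,
        hcardS]
      omega
    refine ⟨ℓ', by rw [← hpfS]; exact hℓ'n, (hAdm _).mpr hadm', (hInv _).mpr ⟨?_, ℓ' * (lvl S hS' / ℓ₀), d', hsq',
      by rw [hpf', hpfS], hadm'', ?_⟩, ?_⟩
    · -- cardinality of the swapped set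
      rw [Finset.card_insert_of_notMem (fun h ↦ (hpfS ▸ hℓ'n) (Finset.mem_of_mem_erase h)), Finset.card_erase_of_mem hℓ₀,
        hcardS]
      omega
    · -- the swapped level keeps the minimum: order exactly `2^(L − Mr)`
      exact addOrderOf_eq_two_pow_of_zsmul_eq_zero_of_ne
        (hmin _ d' hsq' hcard'' (fun q hq ↦ (hAdm q).mp (hadm'' q hq))) hd'
    · -- detection: `2^(a−1) • cls S = 2^(L − Mr − 1) • c_L(d_S) ∉ A ℓ'`
      rw [hcls_eq S hS', two_pow_nsmul_natCast_zsmul, hexp, hAmem]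
      exact fun hmem ↦ hdet (hmem v hv)
  -- the start: attainment
  obtain ⟨n₀, d₀, hn₀, hcard₀, hadm₀, hord₀⟩ := hatt
  have hS₀ : Inv n₀.primeFactors :=
    (hInv _).mpr ⟨hcard₀, n₀, d₀, hn₀, rfl, fun q hq ↦ (hAdm q).mpr (hadm₀ q hq), hord₀⟩
  -- the given generators as a finite subset of `R`
  intro i u hi hu
  let s : Finset (galH1Torsion (W.baseChange K) ((2 ^ L : ℕ) : ℤ)) := Finset.univ.image u
  have hs : (↑s : Set (galH1Torsion (W.baseChange K) ((2 ^ L : ℕ) : ℤ))) ⊆ R := by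
    intro x hx
    obtain ⟨j, -, rfl⟩ := Finset.mem_image.mp (Finset.mem_coe.mp hx)
    exact (hRmem _).mpr (hu j)
  have hsr : s.card ≤ r := (Finset.card_image_le.trans (by rw [Finset.card_univ, Fintype.card_fin])).trans hi
  have hclosure : AddSubgroup.closure (↑s : Set (galH1Torsion (W.baseChange K) ((2 ^ L : ℕ) : ℤ))) =
      AddSubgroup.closure (Set.range u) := by
    simp only [s, Finset.coe_image, Finset.coe_univ, Set.image_univ]
  -- run the loop (gk2-p4's level-exporting form of gk2-p2's weak loop)
  obtain ⟨S, hS, -, hdisj⟩ := exists_inv_avoiding_of_weakSwapOracle_pow Nat.prime_two (M := L)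
    (fun v ↦ AuxiliaryClass.nsmul_galH1Torsion_eq_zero (W := W.baseChange K) (2 ^ L) v) R A Adm r Inv
    (fun S h ↦ ((hInv S).mp h).1) hKloop n₀.primeFactors hS₀ cls (fun _ ↦ Mr' - Mr) ha1 hclsloop horacle s hs hsr
  -- read off the witness
  obtain ⟨hsqS, hpfS, hadmS, hordS⟩ := hdat S hS
  refine ⟨lvl S hS, hsqS, fun q hq ↦ (hAdm q).mp (hadmS q hq), by rw [hpfS, ((hInv S).mp hS).1], dat S hS, hordS, ?_⟩
  rw [← hclosure, ← hcls_eq S hS]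
  exact hdisj

end Summit.BirchSwinnertonDyer.BirchSwinnertonDyer.Theorems.KolyvaginLowerTwo

end
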